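import Mathlib
import Summits.ValiantsHypothesis.ValiantsHypothesis.Theorems.TwoProducts.Negative.CommonPadding
import Summits.ValiantsHypothesis.ValiantsHypothesis.Theorems.TwoProducts.Negative.FullPaddingThresholds
import Summits.ValiantsHypothesis.ValiantsHypothesis.Theorems.TwoProducts.Negative.FullPaddingResidual
import Summits.ValiantsHypothesis.ValiantsHypothesis.Theorems.TwoProducts.Negative.OneSidedPadding
import HarnessLib

/-!
# NEGATIVE lane (val-neg-1 g5): «residual ⇔ PlanarCellBound» survives every padding-stable side condition

Helper file for crux `stmt-ValiantsHypothesis-5906` (filed `--supports`; closes NO item, proves NO summit statement, does NOT prove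
`TwoProducts`, `PlanarCellBound`, any `ResidualLawV…` or VP ≠ VNP; 0 `def`s).  Sequel to `Negative/OneSidedPadding.lean`,
`Negative/FullPaddingThresholds.lean`, `Negative/FullPaddingResidual.lean` (same seat).

`planarCellBound_of_residualV12_restricted`: for EVERY side condition `P m u v` that is inherited by the one-sided deep padding
`(u ∣ z z, v ∣ 0…0)` of `OneSidedPadding.oneSided_spec` (for all `g` and all `N ≥ 1`), the `P`-restricted v12 residual
(«(R5) ∧ (R1_r) ⇒ cells small» for pairs satisfying `P`) implies the `P`-restricted `PlanarCellBound` with `(a, b) ↦ (9a, b + 64a)`; and the two are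
equivalent as `∃ a b` laws (`residualV12_restricted_iff`).  Examples of such `P` (inheritance is elementary, not formalised here): «no factor of
`u` equals a non-trivial factor of `v`» (no common factor), «no non-trivial sub-product of the `1 + u_j` equals a sub-product of the `1 + v_j`»
(irredundant pairs), any condition on `(u, v)` through `logSupport ∩ {|n|₁ < N}` / the cell `S` / the valid weights only.  `P := ⊤` recovers
`FullPaddingResidual.planarCellBound_of_residualV12` (one-sided variant).  READING: restating the residual of `relation_ladder` under any such
normalisation does not separate it from `PlanarCellBound` under the same normalisation.  [folklore]
-/

namespace Summit.ValiantsHypothesis.Theorems.TwoProducts.Negative.OneSidedPaddingResidual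

open Finset MvPolynomial
open Summit.ValiantsHypothesis.ValiantsHypothesis.Theorems.NewtonUnitEquations.TwoProducts.FormalLogLinearisation
open Summit.ValiantsHypothesis.ValiantsHypothesis.Theorems.NewtonUnitEquations.TwoProducts.PlanarCell
open Summit.ValiantsHypothesis.ValiantsHypothesis.Theorems.NewtonUnitEquations.TwoProducts.PermutationType (PermType)
open Summit.ValiantsHypothesis.Theorems.TwoProducts.Negative.CommonPadding
open Summit.ValiantsHypothesis.Theorems.TwoProducts.Negative.FullPaddingThresholds
open Summit.ValiantsHypothesis.Theorems.TwoProducts.Negative.FullPaddingResidual (fullPadding_condition fullPadding_cost)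
open Summit.ValiantsHypothesis.Theorems.TwoProducts.Negative.OneSidedPadding

/-- **`P`-restricted v12 residual ⇒ `P`-restricted `PlanarCellBound`**, for every side condition `P` inherited by the one-sided deep
padding (texts verbatim, the extra hypothesis `P m u v` inserted after the normalisation hypotheses; `(a, b) ↦ (9a, b + 64a)`). [folklore] -/
theorem planarCellBound_of_residualV12_restricted
    (P : (n : ℕ) → (Fin n → MvPolynomial (Fin 2) ℂ) → (Fin n → MvPolynomial (Fin 2) ℂ) → Prop)
    (hP : ∀ (m : ℕ) (u v : Fin m → MvPolynomial (Fin 2) ℂ) (g N : ℕ), 1 ≤ N → P m u v →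
      P (m + (g + g))
        (Fin.append u (Fin.append
          (fun i : Fin g => monomial ((2 * 5 ^ (i : ℕ)) • (N • ∑ f ∈ tailSupport u v, f)) (1 : ℂ) +
            monomial ((2 * (2 * 5 ^ (i : ℕ))) • (N • ∑ f ∈ tailSupport u v, f)) 1)
          (fun i : Fin g => monomial ((2 * 5 ^ (i : ℕ)) • (N • ∑ f ∈ tailSupport u v, f)) (1 : ℂ) +
            monomial ((2 * (2 * 5 ^ (i : ℕ))) • (N • ∑ f ∈ tailSupport u v, f)) 1)))
        (Fin.append v (fun _ : Fin (g + g) => (0 : MvPolynomial (Fin 2) ℂ))))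
    (h : ∃ a b : ℕ, ∀ (m t : ℕ), 2 ≤ t → ∀ (u v : Fin m → MvPolynomial (Fin 2) ℂ),
      (∀ j, coeff 0 (u j) = 0 ∧ (u j).support.card ≤ t) → (∀ j, coeff 0 (v j) = 0 ∧ (v j).support.card ≤ t) → P m u v →
      (∀ (J : Finset (Fin m)) (j₀ : Fin m), j₀ ∈ J →
        BlockSmall (fun j => (u j).support ∪ (v j).support) J (2 ^ m * (t + 2) ^ 4) →
        ¬ PermType (mergeA (fun j => (u j).support ∪ (v j).support) J j₀)) →
      (∀ (r : ℕ) (Jc : Fin r → Finset (Fin m)) (ac bc : Fin r → Fin m → Expo),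
        (∀ a ∈ tuples (fun j => (u j).support ∪ (v j).support), ∀ b ∈ tuples (fun j => (u j).support ∪ (v j).support),
          a ≠ b → ∑ j, a j = ∑ j, b j →
          ∃ k : Fin r, (∀ j, a j ≠ b j ↔ j ∈ Jc k) ∧
            ((∀ j ∈ Jc k, a j = ac k j ∧ b j = bc k j) ∨ (∀ j ∈ Jc k, a j = bc k j ∧ b j = ac k j))) →
        2 ^ m * (t + 2) ^ 4 < 2 * (m + 1) * (3 * (2 + m + m.choose 2) ^ 2) ^ r) →
      ∀ (R : Expo → Expo → Prop) (S : Finset Expo), IsCellFamily u v R S → S.card ≤ 2 ^ (a * m) * (t + 2) ^ b) :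
    ∃ a b : ℕ, ∀ (m t : ℕ), 2 ≤ t → ∀ (u v : Fin m → MvPolynomial (Fin 2) ℂ),
      (∀ j, coeff 0 (u j) = 0 ∧ (u j).support.card ≤ t) → (∀ j, coeff 0 (v j) = 0 ∧ (v j).support.card ≤ t) → P m u v →
      ∀ (R : Expo → Expo → Prop) (S : Finset Expo),
        (∀ l ∈ S, ∃ ξ : Fin 2 → ℝ, ValidWeight u v ξ ∧ IsStrictTop ξ (logSupport u v) l ∧
          ∀ e ∈ ((Finset.univ.biUnion fun j => (u j).support) ∪ Finset.univ.biUnion fun j => (v j).support),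
          ∀ e' ∈ ((Finset.univ.biUnion fun j => (u j).support) ∪ Finset.univ.biUnion fun j => (v j).support),
            (R e e' ↔ wt ξ e ≤ wt ξ e')) →
        S.card ≤ 2 ^ (a * m) * (t + 2) ^ b := by
  obtain ⟨a, b, h⟩ := h
  refine ⟨9 * a, b + 64 * a, fun m t ht u v hu hv hPuv R S hS => ?_⟩
  change IsCellFamily u v R S at hS
  rcases S.eq_empty_or_nonempty with rfl | hne
  · simp
  have hT := tailSupport_nonempty_of_isCellFamily hS hne
  have hs0 := tailSum_ne_zero (fun j => (hu j).1) (fun j => (hv j).1) hT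
  obtain ⟨L, hLdef⟩ : ∃ L, L = Nat.log 2 (t + 2) := ⟨_, rfl⟩
  obtain ⟨k, hk⟩ : ∃ k, k = m + 4 * (L + 1) := ⟨_, rfl⟩
  obtain ⟨N, hNdef⟩ : ∃ N, N = S.sup (fun l : Expo => l 0 + l 1) + 1 := ⟨_, rfl⟩
  have hN : 1 ≤ N := by omega
  have hSN : ∀ l ∈ S, l 0 + l 1 < N := by
    intro l hl
    have := Finset.le_sup (f := fun l : Expo => l 0 + l 1) hl
    omega
  have hlt : t + 2 < 2 ^ (L + 1) := by rw [hLdef]; exact Nat.lt_pow_succ_log_self (by norm_num) _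
  have hle : 2 ^ L ≤ t + 2 := by rw [hLdef]; exact Nat.pow_log_le_self 2 (by omega)
  have hC := fullPadding_condition hlt hk
  have hσ0 : N • ∑ f ∈ tailSupport u v, f ≠ 0 := nsmul_ne_zero' hs0 (by omega)
  obtain ⟨hu', hv', -, -, hcell⟩ := oneSided_spec (g := 4 * k) ht u v hu hv hT N hN _ rfl
  obtain ⟨R', hS'⟩ := hcell R S hS hSN
  exact (h (m + (4 * k + 4 * k)) t ht _ _ hu' hv' (hP m u v (4 * k) N hN hPuv)
    (fullPadding_noSmallPermMerge (t := t) _ hσ0 (oneSided_letters (m := m) (g := 4 * k) u v hs0 N hN _ rfl) hC)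
    (fullPadding_noCheapCover (t := t) _ hσ0 (oneSided_letters (m := m) (g := 4 * k) u v hs0 N hN _ rfl) hC)
    R' S hS').trans (fullPadding_cost a b hle hk)

/-- **The `P`-restricted residual and the `P`-restricted `PlanarCellBound` are equivalent** as `∃ a b` laws. [folklore] -/
theorem residualV12_restricted_iff
    (P : (n : ℕ) → (Fin n → MvPolynomial (Fin 2) ℂ) → (Fin n → MvPolynomial (Fin 2) ℂ) → Prop)
    (hP : ∀ (m : ℕ) (u v : Fin m → MvPolynomial (Fin 2) ℂ) (g N : ℕ), 1 ≤ N → P m u v →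
      P (m + (g + g))
        (Fin.append u (Fin.append
          (fun i : Fin g => monomial ((2 * 5 ^ (i : ℕ)) • (N • ∑ f ∈ tailSupport u v, f)) (1 : ℂ) +
            monomial ((2 * (2 * 5 ^ (i : ℕ))) • (N • ∑ f ∈ tailSupport u v, f)) 1)
          (fun i : Fin g => monomial ((2 * 5 ^ (i : ℕ)) • (N • ∑ f ∈ tailSupport u v, f)) (1 : ℂ) +
            monomial ((2 * (2 * 5 ^ (i : ℕ))) • (N • ∑ f ∈ tailSupport u v, f)) 1)))
        (Fin.append v (fun _ : Fin (g + g) => (0 : MvPolynomial (Fin 2) ℂ)))) :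
    (∃ a b : ℕ, ∀ (m t : ℕ), 2 ≤ t → ∀ (u v : Fin m → MvPolynomial (Fin 2) ℂ),
      (∀ j, coeff 0 (u j) = 0 ∧ (u j).support.card ≤ t) → (∀ j, coeff 0 (v j) = 0 ∧ (v j).support.card ≤ t) → P m u v →
      (∀ (J : Finset (Fin m)) (j₀ : Fin m), j₀ ∈ J →
        BlockSmall (fun j => (u j).support ∪ (v j).support) J (2 ^ m * (t + 2) ^ 4) →
        ¬ PermType (mergeA (fun j => (u j).support ∪ (v j).support) J j₀)) →
      (∀ (r : ℕ) (Jc : Fin r → Finset (Fin m)) (ac bc : Fin r → Fin m → Expo),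
        (∀ a ∈ tuples (fun j => (u j).support ∪ (v j).support), ∀ b ∈ tuples (fun j => (u j).support ∪ (v j).support),
          a ≠ b → ∑ j, a j = ∑ j, b j →
          ∃ k : Fin r, (∀ j, a j ≠ b j ↔ j ∈ Jc k) ∧
            ((∀ j ∈ Jc k, a j = ac k j ∧ b j = bc k j) ∨ (∀ j ∈ Jc k, a j = bc k j ∧ b j = ac k j))) →
        2 ^ m * (t + 2) ^ 4 < 2 * (m + 1) * (3 * (2 + m + m.choose 2) ^ 2) ^ r) →
      ∀ (R : Expo → Expo → Prop) (S : Finset Expo), IsCellFamily u v R S → S.card ≤ 2 ^ (a * m) * (t + 2) ^ b) ↔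
    (∃ a b : ℕ, ∀ (m t : ℕ), 2 ≤ t → ∀ (u v : Fin m → MvPolynomial (Fin 2) ℂ),
      (∀ j, coeff 0 (u j) = 0 ∧ (u j).support.card ≤ t) → (∀ j, coeff 0 (v j) = 0 ∧ (v j).support.card ≤ t) → P m u v →
      ∀ (R : Expo → Expo → Prop) (S : Finset Expo),
        (∀ l ∈ S, ∃ ξ : Fin 2 → ℝ, ValidWeight u v ξ ∧ IsStrictTop ξ (logSupport u v) l ∧
          ∀ e ∈ ((Finset.univ.biUnion fun j => (u j).support) ∪ Finset.univ.biUnion fun j => (v j).support),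
          ∀ e' ∈ ((Finset.univ.biUnion fun j => (u j).support) ∪ Finset.univ.biUnion fun j => (v j).support),
            (R e e' ↔ wt ξ e ≤ wt ξ e')) →
        S.card ≤ 2 ^ (a * m) * (t + 2) ^ b) :=
  ⟨planarCellBound_of_residualV12_restricted P hP, fun ⟨a, b, h⟩ =>
    ⟨a, b, fun m t ht u v hu hv hPuv _ _ R S hS => h m t ht u v hu hv hPuv R S hS⟩⟩

end Summit.ValiantsHypothesis.Theorems.TwoProducts.Negative.OneSidedPaddingResidual
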